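import Mathlib
import HarnessLib
import Summits.ValiantsHypothesis.ValiantsHypothesis.Theorems.LacunarySymmetroidMatrixDescartesProductPlusOneDescartes

/-!
# ValiantsHypothesis / LacunarySymmetroid — crux `MatrixDescartes` (stmt-ValiantsHypothesis-18050, V1),
# LINE (A) `Cruxes/MatrixDescartes/Lines/product_plus_one.lean` (val-idea-25 g0; R266 (A)): the rows `K ≤ 2` of the card's LINEAR class law
# (director R270 (1): separate file, importing val-lit-p4 g14's Descartes row `ProductPlusOneDescartes.ppoLawAt_descartes` by name)

`PPOLinearLaw := ∀ m K, PPOLawAt m K (2·m·K + 3)` (line file l.≈75) is the card's located sharp guess.  For `K ≤ 2` letters it is a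
THEOREM for every `m`, and already by Descartes: binomials on a common support multiply to an `(m+1)`-nomial, so the Descartes row
`2·C(m+K−1, m) − 1` (✓ p646391, val-lit-p4 g14) reads `1` at `K = 1` and `2m + 1` at `K = 2`; `K = 0` is vacuous (`l₀ : Fin 0`).
The first row beyond Descartes is `K = 3` — the line's registered engine stub `stub_classRowK3`.

* `ppoLawAt_le_two_sharp (m K) (hK : K ≤ 2) : PPOLawAt m K (2·m + 1)` (unfolded verbatim);
* ★ `ppoLinearLaw_of_le_two (m K) (hK : K ≤ 2) : PPOLawAt m K (2·m·K + 3)` — the rows `K ≤ 2` of `PPOLinearLaw`, verbatim.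

Honest framing: Descartes bookkeeping for a restricted-V1 rung; `PPOLinearLaw` (K ≥ 3), `PPOPolyLaw`, `ProductPlusOneMDR`,
`MatrixDescartes`, Conjecture B are OPEN; `VP ≠ VNP` is NOT proved.  No definitions, no named facts.
-/

set_option linter.dupNamespace false

noncomputable section

namespace Summit.ValiantsHypothesis.ValiantsHypothesis.Theorems.LacunarySymmetroidMatrixDescartes

namespace ProductPlusOneLowK

open Polynomial
open scoped BigOperators

/-- **Rows `K ≤ 2`, sharp Descartes form:** `PPOLawAt m K (2·m + 1)` for `K ≤ 2` (unfolded verbatim). [folklore] -/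
theorem ppoLawAt_le_two_sharp (m K : ℕ) (hK : K ≤ 2) :
    ∀ (d : Fin K → ℕ) (a : Fin m → Fin K → ℝ) (l₀ : Fin K) (c : ℝ),
      (C c * X ^ (m * d l₀) + ∏ j, ∑ l, C (a j l) * (X : ℝ[X]) ^ (d l)).roots.toFinset.card ≤ 2 * m + 1 := by
  intro d a l₀ c
  refine (ProductPlusOneDescartes.ppoLawAt_descartes m K d a l₀ c).trans ?_
  have hK0 : K ≠ 0 := fun h => by subst h; exact l₀.elim0
  interval_cases K
  · exact (hK0 rfl).elim
  · rw [show m + 1 - 1 = m by omega, Nat.choose_self]; omega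
  · rw [show m + 2 - 1 = m + 1 by omega, Nat.choose_succ_self_right]; omega

/-- ★ **The linear class law holds for `K ≤ 2` letters, every `m`** — rows `K = 0, 1, 2` of the card's `PPOLinearLaw`, i.e.
`PPOLawAt m K (2·m·K + 3)` unfolded verbatim. [folklore] -/
theorem ppoLinearLaw_of_le_two (m K : ℕ) (hK : K ≤ 2) :
    ∀ (d : Fin K → ℕ) (a : Fin m → Fin K → ℝ) (l₀ : Fin K) (c : ℝ),
      (C c * X ^ (m * d l₀) + ∏ j, ∑ l, C (a j l) * (X : ℝ[X]) ^ (d l)).roots.toFinset.card ≤ 2 * m * K + 3 := by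
  intro d a l₀ c
  refine (ppoLawAt_le_two_sharp m K hK d a l₀ c).trans ?_
  have hK1 : 1 ≤ K := Nat.one_le_iff_ne_zero.2 fun h => by subst h; exact l₀.elim0
  nlinarith

end ProductPlusOneLowK

end Summit.ValiantsHypothesis.ValiantsHypothesis.Theorems.LacunarySymmetroidMatrixDescartes

end
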